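import Summits.Schanuel.Schanuel.Theses.RoyCriterion
import Literature.Barriers.Schanuel.LargeTranscendenceDegreeThm29Holds
import Literature.Barriers.Schanuel.NesterenkoModularScopeConjectureProofs

-- `Summit.Schanuel.Schanuel.…` is the mandated layout of this single-problem summit (CONVENTIONS §1).
set_option linter.dupNamespace false

/-!
# Route `RoyCriterion`, crux `SchanuelTwo` (stmt-Schanuel-0069), line `CardA_BW` (skeleton v2) —
# stub `stub_gridExpSector`: the LNM 1752 Ch. 14 Thm 2.9 `t` and `t₁` exponential-rich grid sectors

The crux is Schanuel's conjecture for `n = 2`: for `x : Fin 2 → ℂ` linearly independent over `ℚ`,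
`2 ≤ trdeg_ℚ K_x` with `K_x = ℚ(x, e^x) = IntermediateField.adjoin ℚ (range x ∪ range (exp ∘ x))`.
Line `CardA_BW` is a sector atlas of `K_x`; this file is the GRID-EXP-RICH sector, sibling of the
landed `t₂` sector `stub_gridRichSector`
(`Summits/Schanuel/Schanuel/Theorems/RoyCriterionSchanuelTwoStubGridRichSector.lean`): given a
`ℚ`-linearly independent `X : Fin d → ℂ` and a `ℚ`-linearly independent `Y : Fin ℓ → ℂ`
(`d, ℓ ≥ 1`) whose `dℓ` exponentials `e^{Xᵢ Yⱼ}` are all algebraic over `K_x`, then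
`2 ≤ trdeg_ℚ K_x` as soon as either `2(ℓ + d) ≤ dℓ` (clause `t`), or `d + 2ℓ ≤ dℓ` and the side
`X` is algebraic over `K_x` as well (clause `t₁`).

Engine: `Literature.Barriers.Schanuel.smallTrdeg_thm_2_9_pos_holds`
(`Literature/Barriers/Schanuel/LargeTranscendenceDegreeThm29Holds.lean`, PROVED in tree), the
named fact `smallTrdeg_thm_2_9_pos` = LNM 1752 Ch. 14 Theorem 2.9: clause `t` gives
`2 ≤ trdeg_ℚ (gridField X Y) = trdeg_ℚ ℚ(e^{XᵢYⱼ})`, clause `t₁` gives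
`2 ≤ trdeg_ℚ (gridField₁ X Y) = trdeg_ℚ ℚ(X, e^{XᵢYⱼ})`.
Bookkeeping: the grid data `T` (the exponentials, resp. `range X ∪` the exponentials) is adjoined
to `K_x = ℚ(S)` at no cost in transcendence degree
(`Literature.Barriers.Schanuel.trdeg_adjoin_union_eq_of_isAlgebraic_adjoin`), and the grid field
sits inside `ℚ(S ∪ T)`, so `2 ≤ trdeg ℚ(S ∪ T) = trdeg K_x` by monotonicity
(`Literature.Barriers.Schanuel.trdeg_mono`).

No definitions, no sorry; axioms `propext`, `Classical.choice`, `Quot.sound`.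
-/

noncomputable section

open Complex IntermediateField

namespace Summit.Schanuel.Schanuel.Theorems

/-- **Grid-exp-rich sector** of line `CardA_BW` for crux `SchanuelTwo`: let `K_x = ℚ(x, e^x)`,
`X : Fin d → ℂ` and `Y : Fin ℓ → ℂ` be `ℚ`-linearly independent with `d, ℓ ≥ 1`, and suppose all
the exponentials `e^{Xᵢ Yⱼ}` are algebraic over `K_x`. If `2(ℓ + d) ≤ dℓ`, or if `d + 2ℓ ≤ dℓ`
and every `Xᵢ` is algebraic over `K_x`, then `2 ≤ trdeg_ℚ K_x`.
Proof: LNM 1752 Ch. 14 Theorem 2.9 (clauses `t`, `t₁`), tree theorem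
`Literature.Barriers.Schanuel.smallTrdeg_thm_2_9_pos_holds`, gives `2 ≤ trdeg_ℚ ℚ(e^{XᵢYⱼ})`,
resp. `2 ≤ trdeg_ℚ ℚ(X, e^{XᵢYⱼ})`; that field sits inside `ℚ(S ∪ T)`
(`S = range x ∪ range (exp ∘ x)`, `T` the grid data), whose transcendence degree equals that of
`ℚ(S) = K_x` because `T` is algebraic over `ℚ(S)`.
[cite: NesterenkoPhilippon2001, Ch. 14 Theorem 2.9] -/
theorem stub_gridExpSector :
    ∀ (x : Fin 2 → ℂ) (d l : ℕ) (X : Fin d → ℂ) (Y : Fin l → ℂ), 1 ≤ d → 1 ≤ l →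
      LinearIndependent ℚ X → LinearIndependent ℚ Y →
      (∀ i j, IsAlgebraic ↥(IntermediateField.adjoin ℚ (Set.range x ∪ Set.range (Complex.exp ∘ x)))
        (Complex.exp (X i * Y j))) →
      (2 * (l + d) ≤ d * l ∨ (d + 2 * l ≤ d * l ∧
        ∀ i, IsAlgebraic ↥(IntermediateField.adjoin ℚ (Set.range x ∪ Set.range (Complex.exp ∘ x)))
          (X i))) →
      (2 : Cardinal) ≤ Algebra.trdeg ℚ
        ↥(IntermediateField.adjoin ℚ (Set.range x ∪ Set.range (Complex.exp ∘ x))) := by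
  intro x d l X Y hd hl hX hY hE hnum
  have h29 := Literature.Barriers.Schanuel.smallTrdeg_thm_2_9_pos_holds d l X Y hd hl hX hY
  set S : Set ℂ := Set.range x ∪ Set.range (Complex.exp ∘ x)
  rcases hnum with h0 | ⟨h1, hXa⟩
  · -- clause `t`: `2(ℓ + d) ≤ dℓ`, only the exponentials are needed
    set T : Set ℂ := Set.range (Literature.Barriers.Schanuel.gridExp X Y)
    have hT : ∀ z ∈ T, IsAlgebraic (adjoin ℚ S) z := by
      rintro z ⟨⟨i, j⟩, rfl⟩
      exact hE i j
    have hle : Literature.Barriers.Schanuel.gridField X Y ≤ adjoin ℚ (S ∪ T) := by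
      unfold Literature.Barriers.Schanuel.gridField
      exact adjoin.mono ℚ _ _ Set.subset_union_right
    calc (2 : Cardinal) ≤ Algebra.trdeg ℚ (Literature.Barriers.Schanuel.gridField X Y) := h29.1 h0
      _ ≤ Algebra.trdeg ℚ (adjoin ℚ (S ∪ T)) := Literature.Barriers.Schanuel.trdeg_mono hle
      _ = Algebra.trdeg ℚ (adjoin ℚ S) :=
          Literature.Barriers.Schanuel.trdeg_adjoin_union_eq_of_isAlgebraic_adjoin S T hT
  · -- clause `t₁`: `d + 2ℓ ≤ dℓ`, the exponentials and the side `X`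
    set T : Set ℂ := Set.range X ∪ Set.range (Literature.Barriers.Schanuel.gridExp X Y)
    have hT : ∀ z ∈ T, IsAlgebraic (adjoin ℚ S) z := by
      rintro z (⟨i, rfl⟩ | ⟨⟨i, j⟩, rfl⟩)
      exacts [hXa i, hE i j]
    have hle : Literature.Barriers.Schanuel.gridField₁ X Y ≤ adjoin ℚ (S ∪ T) := by
      unfold Literature.Barriers.Schanuel.gridField₁
      exact adjoin.mono ℚ _ _ Set.subset_union_right
    calc (2 : Cardinal) ≤ Algebra.trdeg ℚ (Literature.Barriers.Schanuel.gridField₁ X Y) :=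
          h29.2.1 h1
      _ ≤ Algebra.trdeg ℚ (adjoin ℚ (S ∪ T)) := Literature.Barriers.Schanuel.trdeg_mono hle
      _ = Algebra.trdeg ℚ (adjoin ℚ S) :=
          Literature.Barriers.Schanuel.trdeg_adjoin_union_eq_of_isAlgebraic_adjoin S T hT

end Summit.Schanuel.Schanuel.Theorems

end
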